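/-
Copyright (c) 2026. All rights reserved.
Released under Apache 2.0 license as described in the file LICENSE.
Authors: abc-iut cell, seat abc-iut-L4-t8 (gen 9; L4-lead row «TYPE-CHOL-THPLUS», file 3: the `TB⊞`-leg of
[AbsTopIII] Def 5.6 (iv) on objects, over `ArchimedeanHolGroupPairs` and abc-iut-w4-d095's `TBPlusCategory`).
-/
import Literature.AnabelianGeometry.AbsoluteAnabelian.ArchimedeanHolGroupPairs
import Literature.AnabelianGeometry.AbsoluteAnabelian.AutHolFieldFunctorMonoAnalyticization
import Literature.AnabelianGeometry.AbsoluteAnabelian.TBPlusCategory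
import Mathlib.Analysis.SpecialFunctions.Complex.LogDeriv
import HarnessLib

/-!
# [AbsTopIII] Def 5.6 (iv): the `TB⊞`-leg `𝒞^hol_{TH⊞} → 𝒞^{hol⊢}_{TB⊞}` on OBJECTS — pulling back the one-parameter subgroups of `ℂ^×`

S. Mochizuki, *Topics in absolute anabelian geometry III*, kurims manuscript (`paper:url-5493eb38cbb7`, read
on the page; bib key `MochizukiAbsTopIII2015`), Def 5.6 (iv) p.136: «Suppose that `(X_ell ↶^κ M_k) ∈
Ob(𝒞^hol_{TH⊞})`.  Recall that the Kummer structure of `(X_ell ↶^κ M_k)` consists of an Aut-holomorphic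
homomorphism from `M_k` to an isomorph of "`ℂ^×` (≅ `S¹ × ℝ_{>0}`)"; observe that the Aut-holomorphic
automorphisms of `Lie(ℂ^×)` of order 4 determine an isomorphism `Lie±(S¹ × {1}) ⥲ Lie±({1} × ℝ_{>0})`.  Thus,
by pulling back to `M_k`, via the Kummer structure of `(X_ell ↶^κ M_k)`, the two one-parameter subgroups
"`S¹ × {1}`, `{1} × ℝ_{>0} ⊆ ℂ^×`", we obtain, in a natural way, an object of `𝒞^{hol⊢}_{TB⊞}`» (Def 5.6 (i)
p.134: `TB⊞`, abc-iut-L4-t3's `TBPlus`; category structure abc-iut-w4-d095's `TBPlusCategory`).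

This file constructs the `TB⊞`-component `(B, B′, B″, β)` of that object for every `(𝕏 ↶ M) ∈ 𝒞^hol_{TH⊞}`
(`HolTHPlusPair`, file 1): `B := M` (the Aut-holomorphic group as a topological abelian group); `B′`, `B″`
the one-parameter subgroups obtained by PULLING BACK `exp(iℝ) = S¹` and `exp(ℝ) = ℝ_{>0}` along the Kummer
homomorphism `κ : M → 𝒜_𝕏^×`, parametrised through the exponential coordinate of a (chosen, bicontinuous)
chart `k ⥲ ℂ` of the presenting CAF — `c₁(s) = pres⁻¹(param(is))`, `c₂(t) = pres⁻¹(param(t))` with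
`param(z) = e⁻¹(exp z)` on `k^×`, `e⁻¹(z)` on `k∼` (`THPlusShape.param`) —; `β := 1` (the order-4
automorphism `z ↦ −iz` of `Lie(ℂ^×) = ℂ` carries the tangent `i` of `s ↦ e^{is}` to the tangent `1` of
`t ↦ e^t`; the sign is absorbed by `Lie±`).  The typed `TB⊞`-axioms are PROVED: local injectivity
(`exp(is)` is injective for `|s| < π`), `B′ ∩ B″ = 0` (`|e^{is}| = 1`), `B′ × B″ → B` onto (polar
decomposition = surjectivity of `exp` onto `ℂ^×`) and open (`exp` is an open map):

* `THPlusShape.param`, `param_add`, `kummer_param` (`κ(param z) = (c ∘ e⁻¹)(exp z)` for BOTH shapes),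
  `param_surjOn`, `isOpenMap_param`, `param_I_injOn`, `param_real_injective`, `param_I_eq_param_real`;
* `HolTHPlusPair.chart` (a chosen bicontinuous `k ⥲ ℂ`), `pres_symm_op`, `pres_zero`;
* `HolTHPlusPair.oneParam P w : ℝ →ₜ+ P.B` (`t ↦ pres⁻¹(param(w t))`), `κ_oneParam`;
* ★ `HolTHPlusPair.toTBPlusObj P : TBPlus` and its `rfl` field lemmas.

The functor (morphisms: `φ_M` with rescalings `a₁ = ±1` by the dichotomy `{id, conj}` for continuous
automorphisms of `ℂ`, `a₂ = 1`) and the `TM⊢`/Kummer-structure components of the triple are the sequel file.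
Refereed pre-IUT material; a MODEL (kernel definitions); no instances, no notation; nothing here bears on
[IUTchIII] Cor. 3.12; typed ≠ proved.
-/

set_option autoImplicit false

noncomputable section

namespace Literature.AnabelianGeometry.AbsoluteAnabelian

open _root_.CategoryTheory _root_.Topology _root_.Complex

universe u

/-! ### §1 The exponential coordinate of a shape -/

namespace THPlusShape

variable {k : Type u} [NormedField k]

/-- The identity element of the shape's group inside `k`: `1` for `k^×`, `0` for `k∼`.
[cite: MochizukiAbsTopIII2015, Definition 4.1 (i) p.101] -/
def unit (s : THPlusShape) : k :=
  match s with
  | times => 1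
  | sim => 0

/-- The unit lies in the carrier. [cite: MochizukiAbsTopIII2015, Definition 4.1 (i) p.101] -/
theorem unit_mem (s : THPlusShape) : (s.unit : k) ∈ s.carrier k := by
  cases s
  · exact one_ne_zero
  · exact Set.mem_univ _

/-- In the shape's group an idempotent element of the carrier is the unit (`x·x = x ⇒ x = 1` on `k^×`,
`x + x = x ⇒ x = 0`). [cite: MochizukiAbsTopIII2015, Definition 4.1 (i) p.101] -/
theorem eq_unit_of_op_self (s : THPlusShape) {x : k} (hx : x ∈ s.carrier k) (h : s.op x x = x) :
    x = s.unit := by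
  cases s
  · change x * x = x at h
    change x ≠ 0 at hx
    have : x * x = x * 1 := by rw [h, mul_one]
    exact mul_left_cancel₀ hx this
  · change x + x = x at h
    change x = 0
    have : x + x = x + 0 := by rw [h, add_zero]
    exact add_left_cancel this

/-- **The exponential coordinate** of the shape through a chart `e : k ⥲ ℂ`: `z ↦ e⁻¹(exp z)` for `k^×`,
`z ↦ e⁻¹(z)` for `k∼` — a parametrisation of the group by `Lie(ℂ^×) = ℂ`.
[cite: MochizukiAbsTopIII2015, Definition 5.6 (iv) p.136] -/
def param (s : THPlusShape) (e : k ≃+* ℂ) (z : ℂ) : k :=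
  match s with
  | times => e.symm (exp z)
  | sim => e.symm z

/-- The exponential coordinate lands in the carrier. [cite: MochizukiAbsTopIII2015, Definition 5.6 (iv) p.136] -/
theorem param_mem (s : THPlusShape) (e : k ≃+* ℂ) (z : ℂ) : s.param e z ∈ s.carrier k := by
  cases s
  · exact (map_ne_zero_iff _ e.symm.injective).mpr (exp_ne_zero z)
  · exact Set.mem_univ _

/-- The exponential coordinate is a homomorphism `(ℂ, +) →` the shape's group.
[cite: MochizukiAbsTopIII2015, Definition 5.6 (iv) p.136] -/
theorem param_add (s : THPlusShape) (e : k ≃+* ℂ) (z w : ℂ) :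
    s.param e (z + w) = s.op (s.param e z) (s.param e w) := by
  cases s
  · change e.symm (exp (z + w)) = e.symm (exp z) * e.symm (exp w)
    rw [exp_add, map_mul]
  · exact map_add e.symm z w

/-- The exponential coordinate at `0` is the unit. [cite: MochizukiAbsTopIII2015, Definition 5.6 (iv) p.136] -/
theorem param_zero (s : THPlusShape) (e : k ≃+* ℂ) : s.param e 0 = s.unit := by
  cases s
  · change e.symm (exp 0) = 1
    rw [exp_zero, map_one]
  · exact map_zero e.symm

/-- **The Kummer homomorphism in the exponential coordinate is `exp` for BOTH shapes**:
`κ(param z) = (c ∘ e⁻¹)(exp z)`. [cite: MochizukiAbsTopIII2015, Definition 5.6 (iv) p.136] -/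
theorem kummer_param [CharZero k] {A : Type u} [NormedField A] (s : THPlusShape) (c : k ≃+* A)
    (e : k ≃+* ℂ) (he : Continuous e.symm) (z : ℂ) :
    s.kummer c (s.param e z) = c (e.symm (exp z)) := by
  cases s
  · rfl
  · change c (univCover k (e.symm z)) = _
    rw [IsCAF.univCover_symm_apply e he z]

/-- The exponential coordinate is continuous (for a bicontinuous chart). [cite: MochizukiAbsTopIII2015, Definition 5.6 (iv) p.136] -/
theorem continuous_param (s : THPlusShape) (e : k ≃+* ℂ) (he : Continuous e.symm) : Continuous (s.param e) := by
  cases s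
  · exact he.comp continuous_exp
  · exact he

/-- The exponential coordinate is ONTO the carrier (every element of `ℂ^×` is an exponential).
[cite: MochizukiAbsTopIII2015, Definition 5.6 (iv) p.136] -/
theorem param_surjOn (s : THPlusShape) (e : k ≃+* ℂ) {x : k} (hx : x ∈ s.carrier k) :
    ∃ z : ℂ, s.param e z = x := by
  cases s
  · refine ⟨log (e x), ?_⟩
    change e.symm (exp (log (e x))) = x
    rw [exp_log ((map_ne_zero_iff _ e.injective).mpr hx), RingEquiv.symm_apply_apply]
  · exact ⟨e x, e.symm_apply_apply x⟩

/-- The exponential coordinate is an open map (`exp` is open). [cite: MochizukiAbsTopIII2015, Definition 5.6 (iv) p.136] -/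
theorem isOpenMap_param (s : THPlusShape) (e : k ≃+* ℂ) (he : Continuous e) (he' : Continuous e.symm) :
    IsOpenMap (s.param e) := by
  have hsymm : IsOpenMap e.symm := (ringEquivHomeomorph e he he').symm.isOpenMap
  cases s
  · exact hsymm.comp isOpenMap_exp
  · exact hsymm

/-- `s ↦ param(is)` is injective for `|s| < π` (`exp` is injective on `|Im| < π`).
[cite: MochizukiAbsTopIII2015, Definition 5.6 (iv) p.136] -/
theorem param_I_injOn (s : THPlusShape) (e : k ≃+* ℂ) :
    Set.InjOn (fun t : ℝ => s.param e (I * t)) (Set.Ioo (-Real.pi) Real.pi) := by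
  intro a ha b hb hab
  cases s
  · change e.symm (exp (I * a)) = e.symm (exp (I * b)) at hab
    have h := e.symm.injective hab
    have hima : (I * (a : ℂ)).im = a := by simp
    have himb : (I * (b : ℂ)).im = b := by simp
    have hπa := ha.1; have hπa' := ha.2; have hπb := hb.1; have hπb' := hb.2
    have heq := exp_inj_of_neg_pi_lt_of_le_pi (by rw [hima]; exact hπa) (by rw [hima]; exact hπa'.le)
      (by rw [himb]; exact hπb) (by rw [himb]; exact hπb'.le) h
    have := congrArg Complex.im heq
    rwa [hima, himb] at this
  · change e.symm (I * a) = e.symm (I * b) at hab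
    have h := e.symm.injective hab
    have := congrArg Complex.im h
    simpa using this

/-- `t ↦ param(t)` (`t` real) is injective (`exp` is injective on `ℝ`).
[cite: MochizukiAbsTopIII2015, Definition 5.6 (iv) p.136] -/
theorem param_real_injective (s : THPlusShape) (e : k ≃+* ℂ) :
    Function.Injective (fun t : ℝ => s.param e t) := by
  intro a b hab
  cases s
  · change e.symm (exp a) = e.symm (exp b) at hab
    have h := e.symm.injective hab
    have := congrArg Complex.re h
    rw [exp_ofReal_re, exp_ofReal_re] at this
    exact Real.exp_injective this
  · change e.symm a = e.symm b at hab
    exact_mod_cast e.symm.injective hab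

/-- If `param(is) = param(t)` with `s, t` real then `t = 0` and `param(is)` is the unit (`|e^{is}| = 1`
meets `e^t > 0` only at `1`). [cite: MochizukiAbsTopIII2015, Definition 5.6 (iv) p.136] -/
theorem param_I_eq_param_real (s : THPlusShape) (e : k ≃+* ℂ) {a t : ℝ}
    (h : s.param e (I * a) = s.param e t) : s.param e (I * a) = s.unit := by
  cases s
  · change e.symm (exp (I * a)) = e.symm (exp t) at h
    change e.symm (exp (I * a)) = 1
    have h1 := e.symm.injective h
    have hn : ‖exp (I * a)‖ = 1 := by rw [mul_comm]; exact norm_exp_ofReal_mul_I a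
    have ht : Real.exp t = 1 := by
      have := congrArg norm h1
      rw [hn, norm_exp, ofReal_re] at this
      exact this.symm
    have ht0 : (t : ℂ) = 0 := by rw [Real.exp_eq_one_iff] at ht; simp [ht]
    rw [h1, ht0, exp_zero, map_one]
  · change e.symm (I * a) = e.symm t at h
    change e.symm (I * a) = 0
    have h1 := e.symm.injective h
    have ha : a = 0 := by
      have := congrArg Complex.im h1
      simpa using this
    rw [ha, ofReal_zero, mul_zero, map_zero]

end THPlusShape

/-! ### §2 The `TB⊞`-object of a `TH⊞`-pair: `B = M`, `B′`, `B″` pulled back along the Kummer homomorphism -/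

namespace HolTHPlusPair

variable {𝔄 : AutHolFieldFunctor.{u}}

/-- THE chart `k ⥲ ℂ` of the presenting CAF used for the exponential coordinate: the Kummer chart `c`
followed by abc-iut-w6-d025's CAF chart `e_𝕏 = cafChart 𝕏 : 𝒜_𝕏 ⥲ ℂ` of `AutHolFieldFunctorMonoAnalyticization`
(so that the field automorphism of `ℂ` induced by a morphism is exactly `AutHolFieldFunctor.transition φ_𝕏`).
[cite: MochizukiAbsTopIII2015, Definition 5.6 (iv) p.136] -/
def chart (P : HolTHPlusPair 𝔄) : P.k ≃+* ℂ := P.c.trans (𝔄.cafChart P.X)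

/-- The chart, evaluated. [cite: MochizukiAbsTopIII2015, Definition 5.6 (iv) p.136] -/
theorem chart_apply (P : HolTHPlusPair 𝔄) (x : P.k) : P.chart x = 𝔄.cafChart P.X (P.c x) := rfl

/-- The inverse chart, evaluated. [cite: MochizukiAbsTopIII2015, Definition 5.6 (iv) p.136] -/
theorem chart_symm_apply (P : HolTHPlusPair 𝔄) (z : ℂ) : P.chart.symm z = P.c.symm ((𝔄.cafChart P.X).symm z) := rfl

/-- The chart is continuous. [cite: MochizukiAbsTopIII2015, Definition 5.6 (iv) p.136] -/
theorem continuous_chart (P : HolTHPlusPair 𝔄) : Continuous P.chart :=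
  (𝔄.continuous_cafChart P.X).comp P.continuous_c

/-- The inverse chart is continuous. [cite: MochizukiAbsTopIII2015, Definition 5.6 (iv) p.136] -/
theorem continuous_chart_symm (P : HolTHPlusPair 𝔄) : Continuous P.chart.symm :=
  P.continuous_c_symm.comp (𝔄.continuous_cafChart_symm P.X)

/-- The presentation carries `0` to the unit of the shape's group. [cite: MochizukiAbsTopIII2015, Definition 4.1 (ii) p.102] -/
theorem pres_zero (P : HolTHPlusPair 𝔄) : (P.pres 0 : P.k) = P.shape.unit := by
  refine THPlusShape.eq_unit_of_op_self _ (P.pres 0).2 ?_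
  have h := P.pres_add 0 0
  rw [add_zero] at h
  exact h.symm

/-- The presentation turns the shape's law into the addition of `B` (inverse direction).
[cite: MochizukiAbsTopIII2015, Definition 4.1 (ii) p.102] -/
theorem pres_symm_add (P : HolTHPlusPair 𝔄) (x y : P.shape.carrier P.k) :
    (P.pres (P.pres.symm x + P.pres.symm y) : P.k) = P.shape.op (x : P.k) (y : P.k) := by
  rw [P.pres_add, Homeomorph.apply_symm_apply, Homeomorph.apply_symm_apply]

/-- **The one-parameter subgroups pulled back along the Kummer homomorphism**: for `w ∈ ℂ` the
continuous homomorphism `t ↦ pres⁻¹(param(w·t)) : ℝ → M` (`w = i`: the pull-back of `S¹ = exp(iℝ)`;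
`w = 1`: the pull-back of `ℝ_{>0} = exp(ℝ)`). [cite: MochizukiAbsTopIII2015, Definition 5.6 (iv) p.136] -/
def oneParam (P : HolTHPlusPair 𝔄) (w : ℂ) : ℝ →ₜ+ P.B where
  toFun t := P.pres.symm ⟨P.shape.param P.chart (w * t), THPlusShape.param_mem _ _ _⟩
  map_zero' := by
    have h : (⟨P.shape.param P.chart (w * ((0 : ℝ) : ℂ)), THPlusShape.param_mem _ _ _⟩ :
        P.shape.carrier P.k) = P.pres 0 := by
      apply Subtype.ext
      change P.shape.param P.chart (w * ((0 : ℝ) : ℂ)) = (P.pres 0 : P.k)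
      rw [ofReal_zero, mul_zero, THPlusShape.param_zero, pres_zero]
    rw [h, Homeomorph.symm_apply_apply]
  map_add' s t := by
    apply P.pres.injective
    apply Subtype.ext
    rw [Homeomorph.apply_symm_apply, pres_symm_add]
    change P.shape.param P.chart (w * ((s + t : ℝ) : ℂ)) =
      P.shape.op (P.shape.param P.chart (w * s)) (P.shape.param P.chart (w * t))
    rw [ofReal_add, mul_add, THPlusShape.param_add]
  continuous_toFun :=
    P.pres.symm.continuous.comp (((THPlusShape.continuous_param _ _ P.continuous_chart_symm).comp
      (continuous_const.mul continuous_ofReal)).subtype_mk _)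

/-- The pulled-back one-parameter subgroup, evaluated. [cite: MochizukiAbsTopIII2015, Definition 5.6 (iv) p.136] -/
theorem oneParam_apply (P : HolTHPlusPair 𝔄) (w : ℂ) (t : ℝ) :
    P.oneParam w t = P.pres.symm ⟨P.shape.param P.chart (w * t), THPlusShape.param_mem _ _ _⟩ := rfl

/-- **The Kummer homomorphism on the pulled-back one-parameter subgroups is `exp`**:
`κ(c_w(t)) = (c ∘ e⁻¹)(exp(w t))` — so `κ(B′) = S¹`, `κ(B″) = ℝ_{>0}` inside `𝒜_𝕏^× ≅ ℂ^×`.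
[cite: MochizukiAbsTopIII2015, Definition 5.6 (iv) p.136] -/
theorem κ_oneParam (P : HolTHPlusPair 𝔄) (w : ℂ) (t : ℝ) :
    P.κ (P.oneParam w t) = P.c (P.chart.symm (exp (w * t))) := by
  rw [oneParam_apply, κ_def, Homeomorph.apply_symm_apply]
  exact @THPlusShape.kummer_param P.k _ P.charZero_k _ _ _ _ _ P.continuous_chart_symm _

/-- The map `(s, t) ↦ i s + t : ℝ × ℝ → ℂ` is an open map (a real-linear homeomorphism).
[cite: MochizukiAbsTopIII2015, Definition 5.6 (i) p.134] -/
theorem isOpenMap_I_mul_add : IsOpenMap (fun p : ℝ × ℝ => I * (p.1 : ℂ) + (p.2 : ℂ)) := by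
  have h : (fun p : ℝ × ℝ => I * (p.1 : ℂ) + (p.2 : ℂ)) =
      (fun p : ℝ × ℝ => equivRealProdCLM.symm p) ∘ Prod.swap := by
    funext p
    rw [Function.comp_apply, Prod.swap, equivRealProdCLM_symm_apply]
    ring
  rw [h]
  exact equivRealProdCLM.symm.toHomeomorph.isOpenMap.comp (Homeomorph.prodComm ℝ ℝ).isOpenMap

/-- ★ **The `TB⊞`-object `(B, B′, B″, β)` of a `TH⊞`-pair** (Def 5.6 (iv)): `B := M`; `B′`, `B″` the pull-backs
along the Kummer homomorphism `κ : M → 𝒜_𝕏^×` of the one-parameter subgroups `S¹ = exp(iℝ)` and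
`ℝ_{>0} = exp(ℝ)` of `ℂ^×`, parametrised through the exponential coordinate; `β := 1` (the order-4
automorphism `z ↦ −iz` of `Lie(ℂ^×)` carries the tangent `i` of `B′` to the tangent `1` of `B″`; signs are
absorbed by `Lie±`).  The `TB⊞`-axioms are proved: `exp(is)` is injective for `|s| < π`, `|e^{is}| = 1`
meets `e^t` only at `1`, `exp` is onto `ℂ^×` and open. [cite: MochizukiAbsTopIII2015, Definition 5.6 (iv) p.136] -/
def toTBPlusObj (P : HolTHPlusPair 𝔄) : TBPlus.{u} where
  B := P.B
  c₁ := P.oneParam I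
  c₂ := P.oneParam 1
  exists_injOn := by
    refine ⟨Real.pi, Real.pi_pos, fun a ha b hb hab => ?_, fun a _ b _ hab => ?_⟩
    · have h := congrArg (fun x : P.shape.carrier P.k => (x : P.k))
        (P.pres.symm.injective (show P.oneParam I a = P.oneParam I b from hab))
      exact THPlusShape.param_I_injOn _ _ ha hb h
    · have h := congrArg (fun x : P.shape.carrier P.k => (x : P.k))
        (P.pres.symm.injective (show P.oneParam 1 a = P.oneParam 1 b from hab))
      have h' : P.shape.param P.chart a = P.shape.param P.chart b := by
        simpa only [one_mul] using h
      exact THPlusShape.param_real_injective _ _ h'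
  add_injective s t hst := by
    have h := congrArg (fun x : P.shape.carrier P.k => (x : P.k))
      (P.pres.symm.injective (show P.oneParam I s = P.oneParam 1 t from hst))
    have h' : P.shape.param P.chart (I * s) = P.shape.param P.chart t := by
      simpa only [one_mul] using h
    have hu := THPlusShape.param_I_eq_param_real _ _ h'
    change P.oneParam I s = 0
    rw [oneParam_apply]
    have : (⟨P.shape.param P.chart (I * s), THPlusShape.param_mem _ _ _⟩ : P.shape.carrier P.k) = P.pres 0 :=
      Subtype.ext (hu.trans P.pres_zero.symm)
    rw [this, Homeomorph.symm_apply_apply]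
  add_surjective b := by
    obtain ⟨z, hz⟩ := THPlusShape.param_surjOn P.shape P.chart (P.pres b).2
    refine ⟨(z.im, z.re), ?_⟩
    change P.oneParam I z.im + P.oneParam 1 z.re = b
    apply P.pres.injective
    apply Subtype.ext
    rw [oneParam_apply, oneParam_apply, pres_symm_add]
    change P.shape.op (P.shape.param P.chart (I * (z.im : ℂ))) (P.shape.param P.chart (1 * (z.re : ℂ))) = _
    rw [← THPlusShape.param_add, one_mul, ← hz]
    congr 1
    rw [mul_comm, add_comm]
    exact re_add_im z
  isOpenMap_add := by
    -- `(s, t) ↦ c₁ s + c₂ t = pres⁻¹ (param (i s + t))`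
    have hfun : (fun p : ℝ × ℝ => P.oneParam I p.1 + P.oneParam 1 p.2) =
        P.pres.symm ∘ (fun z : ℂ => (⟨P.shape.param P.chart z, THPlusShape.param_mem _ _ _⟩ :
          P.shape.carrier P.k)) ∘ (fun p : ℝ × ℝ => I * (p.1 : ℂ) + (p.2 : ℂ)) := by
      funext p
      apply P.pres.injective
      apply Subtype.ext
      rw [oneParam_apply, oneParam_apply, pres_symm_add, Function.comp_apply, Function.comp_apply,
        Homeomorph.apply_symm_apply]
      change P.shape.op (P.shape.param P.chart (I * (p.1 : ℂ))) (P.shape.param P.chart (1 * (p.2 : ℂ))) = _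
      rw [← THPlusShape.param_add, one_mul]
    rw [hfun]
    refine P.pres.symm.isOpenMap.comp (IsOpenMap.comp ?_ isOpenMap_I_mul_add)
    -- corestriction of the open map `param` to the open carrier is open
    intro U hU
    rw [(P.shape.isOpen_carrier.isOpenEmbedding_subtypeVal).isOpen_iff_image_isOpen]
    have : Subtype.val '' ((fun z : ℂ => (⟨P.shape.param P.chart z, THPlusShape.param_mem _ _ _⟩ :
        P.shape.carrier P.k)) '' U) = P.shape.param P.chart '' U := by
      rw [← Set.image_comp]
      rfl
    rw [this]
    exact THPlusShape.isOpenMap_param _ _ P.continuous_chart P.continuous_chart_symm U hU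
  β := 1
  β_pos := one_pos

/-- The group of the `TB⊞`-object is `M`. [cite: MochizukiAbsTopIII2015, Definition 5.6 (iv) p.136] -/
theorem toTBPlusObj_B (P : HolTHPlusPair 𝔄) : P.toTBPlusObj.B = P.B := rfl

/-- `B′` is the pull-back of `S¹`. [cite: MochizukiAbsTopIII2015, Definition 5.6 (iv) p.136] -/
theorem toTBPlusObj_c₁ (P : HolTHPlusPair 𝔄) : P.toTBPlusObj.c₁ = P.oneParam I := rfl

/-- `B″` is the pull-back of `ℝ_{>0}`. [cite: MochizukiAbsTopIII2015, Definition 5.6 (iv) p.136] -/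
theorem toTBPlusObj_c₂ (P : HolTHPlusPair 𝔄) : P.toTBPlusObj.c₂ = P.oneParam 1 := rfl

/-- `β = 1`. [cite: MochizukiAbsTopIII2015, Definition 5.6 (iv) p.136] -/
theorem toTBPlusObj_β (P : HolTHPlusPair 𝔄) : P.toTBPlusObj.β = 1 := rfl

/-- `κ(B′) ⊆ S¹`: `κ(c₁ s) = (c ∘ e⁻¹)(e^{is})`. [cite: MochizukiAbsTopIII2015, Definition 5.6 (iv) p.136] -/
theorem κ_c₁ (P : HolTHPlusPair 𝔄) (s : ℝ) :
    P.κ (P.toTBPlusObj.c₁ s) = P.c (P.chart.symm (exp (I * s))) := κ_oneParam P I s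

/-- `κ(B″) ⊆ ℝ_{>0}`: `κ(c₂ t) = (c ∘ e⁻¹)(e^{t})`. [cite: MochizukiAbsTopIII2015, Definition 5.6 (iv) p.136] -/
theorem κ_c₂ (P : HolTHPlusPair 𝔄) (t : ℝ) :
    P.κ (P.toTBPlusObj.c₂ t) = P.c (P.chart.symm (exp t)) := by
  rw [show (exp (t : ℂ)) = exp (1 * (t : ℂ)) by rw [one_mul]]
  exact κ_oneParam P 1 t

end HolTHPlusPair

end Literature.AnabelianGeometry.AbsoluteAnabelian

end
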